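import Mathlib
import Summits.CriticalPhenomena.PercolationContinuityZ3.Theorems.PercNearOneGluingNoHeavyLowerTailOrientedAntipodalHallEnlargedCalculus

/-!
# Two-group certificates in a partial one-sided enlargement — a uniform oriented antipodal Hall theorem

Helper file for crux `stmt-CriticalPhenomena-4575` (`NoHeavyLowerTail`, route `PercNearOneGluingNoHeavy`),
new-inequality factory seat `prim-ineq-gen-3` (gen 13).  Everything here is PROVED.

Setting of `…OrientedAntipodalHall`: `f : Finset α → Lab k` monotone, ground set `S`, a family `D` of antipodal
bads (`f X = C_{i X}`, `f (S \ X) = C_{j X}`), good sets (`f U = A`, `f (S \ U) = B`).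

**The certificate.**  Fix a set `R` of petals and count against the PARTIAL ONE-SIDED ENLARGEMENT
`G_R = {F ⊆ S : f F = B, f (S \ F) ∈ {A} ∪ C_R, F ⊆ S \ X for some X ∈ D}` of the co-goods above `D`.  Elements:
the complemented members `S \ X` (labels `a = j X`, `b = i X`) and the pseudo-sets `E ∈ G_R` with `f (S \ E) = C_r`
(`a = B`, `b = r ∈ R`).  Each type and each pseudo-class gets a GROUP (one of two) and a RANK; the label conditions
of `card_le_card_goods_above_of_twoGroupCert` say exactly that (i) inside a group the elements form a RANKED
Marica–Schönheim family of `ℚ^{G_R}` (`rank U ≤ rank U' ⇒ U \ U' ∈ G_R`, `rank U < rank U' ⇒ U ⊄ U'`) and (ii) across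
the two groups all meets are certified members of `G_R` and nonempty (B-orthogonality).  Then (two B-orthogonal
independent families, `ThreeFamilyRank.card_add_card_le_of_rank`) `#D + #Ψ ≤ #G_R = #K₀ + #Ψ`, so `#D ≤ #goods
above D`; `exists_injective_good_above_of_twoGroupCert` is the SDR form.  No rigidity theorem is used.

**Reach** (memo FINDINGS-gen13.md, `run/shared/lean/prim/prim-ineq-gen-3/`, code `code-gen13/cert13.py`): such a
certificate exists for ALL 6 opposite-free classes on three petals, ALL 41 on four petals (re-proving gens 9–12
uniformly, e.g. the cyclic triangle with `R = {0}`: `(D₀₁ᶜ ∪ 𝒴₀ ; D₂₀ᶜ) ⟂ D₁₂ᶜ`) and 578 of the 581 classes on five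
petals (all but three tournaments); the acyclic classes are the one-group case (`…Acyclic`).
(prim-ineq-gen-3 gen 13, 2026-08-21.)
-/
namespace Summit.CriticalPhenomena.PercolationContinuityZ3.Theorems

namespace OrientedAntipodalHall

open Finset Module AntipodalStrongHarris AntipodalStrongHarris.Lab ThreeFamilyRank
open scoped FinsetFamily

variable {α : Type*} [DecidableEq α] {k : ℕ}

/-- **Uniform oriented antipodal Hall theorem from a two-group certificate, counting form.**  `f` monotone, `D` a
family of antipodal bads of `S` (`f X = C_{i X}`, `f (S \ X) = C_{j X}`).  A certificate consists of a set `R` of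
enlargement petals, a group bit and a rank for every type (`gM p q`, `rM p q`) and for every pseudo-class (`gΨ`,
`rΨ r`), subject to the label conditions `hMM` (member/member pairs) and `hMΨ` (member/pseudo pairs) below — they
state that inside a group the complemented members and the pseudo-sets form a ranked Marica–Schönheim family of
`ℚ^{G_R}` and that across the two groups all meets are certified and nonempty.  Then at least `#D` good sets lie
above members of `D`. -/
theorem card_le_card_goods_above_of_twoGroupCert (S : Finset α) {f : Finset α → Lab k}
    (hf : ∀ ⦃X Y : Finset α⦄, X ⊆ Y → f X ≤ f Y) (D : Finset (Finset α)) (i j : Finset α → Fin k)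
    (hDS : ∀ X ∈ D, X ⊆ S) (hDi : ∀ X ∈ D, f X = petal (i X)) (hDj : ∀ X ∈ D, f (S \ X) = petal (j X))
    (R : Finset (Fin k)) (gM : Fin k → Fin k → Bool) (rM : Fin k → Fin k → ℕ) (gΨ : Bool) (rΨ : Fin k → ℕ)
    (hMM : ∀ X ∈ D, ∀ X' ∈ D,
      (gM (i X) (j X) = gM (i X') (j X') → rM (i X) (j X) ≤ rM (i X') (j X') →
        (j X ≠ i X' ∧ (i X ∈ R ∨ i X ≠ j X'))) ∧
      (gM (i X) (j X) ≠ gM (i X') (j X') →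
        (j X ≠ j X' ∧ (i X ≠ i X' ∨ i X ∈ R) ∧ ¬ (j X' = i X ∧ j X = i X'))))
    (hMΨ : ∀ X ∈ D, ∀ r ∈ R,
      (gM (i X) (j X) = gΨ →
        (rΨ r < rM (i X) (j X) → r ≠ i X) ∧ (rM (i X) (j X) ≤ rΨ r → (j X ≠ r ∧ i X ∈ R))) ∧
      (gM (i X) (j X) ≠ gΨ → ((i X ≠ r ∨ i X ∈ R) ∧ j X ≠ r))) :
    #D ≤ #{U ∈ S.powerset | f U = top ∧ f (S \ U) = bot ∧ ∃ X ∈ D, X ⊆ U} := by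
  classical
  set G : Finset (Finset α) := {F ∈ S.powerset | f F = bot ∧ (f (S \ F) = top ∨ ∃ r ∈ R, f (S \ F) = petal r) ∧
    ∃ X ∈ D, F ⊆ S \ X} with hG
  set Ψ : Finset (Finset α) := {F ∈ G | f (S \ F) ≠ top} with hΨ
  set K : Finset (Finset α) := {F ∈ G | f (S \ F) = top} with hK
  set M : Finset (Finset α) := D.image (fun X => S \ X) with hM
  -- `G` is down-closed
  have hGdown : ∀ E ∈ G, ∀ F, F ⊆ E → F ∈ G := by
    intro E hE F hFE
    rw [hG, mem_filter, mem_powerset] at hE ⊢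
    obtain ⟨hES, hEbot, hElab, X, hX, hEX⟩ := hE
    refine ⟨hFE.trans hES, eq_bot_of_le_bot (hEbot ▸ hf hFE), ?_, X, hX, hFE.trans hEX⟩
    have hle : f (S \ E) ≤ f (S \ F) := hf (sdiff_subset_sdiff (le_refl S) hFE)
    rcases hElab with htop | ⟨r, hrR, hr⟩
    · rw [htop, le_def] at hle
      rcases hle with h | h | h
      · simp at h
      · exact Or.inl h
      · exact Or.inl h.symm
    · rw [hr] at hle
      rcases eq_or_eq_top_of_petal_le hle with h | h
      · exact Or.inr ⟨r, hrR, h⟩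
      · exact Or.inl h
  -- rank and group of a set, read off its labels
  let ρ : Finset α → ℕ := fun U => match f U, f (S \ U) with
    | bot, petal r => rΨ r
    | petal q, petal p => rM p q
    | _, _ => 0
  let γ : Finset α → Bool := fun U => match f U, f (S \ U) with
    | bot, petal _ => gΨ
    | petal q, petal p => gM p q
    | _, _ => false
  have hρM : ∀ U (p q : Fin k), f U = petal q → f (S \ U) = petal p → ρ U = rM p q ∧ γ U = gM p q := by
    intro U p q hq hp
    constructor <;> simp [ρ, γ, hq, hp]
  have hρΨ : ∀ U (r : Fin k), f U = bot → f (S \ U) = petal r → ρ U = rΨ r ∧ γ U = gΨ := by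
    intro U r hb hr
    constructor <;> simp [ρ, γ, hb, hr]
  -- description of the elements of the family `M ∪ Ψ`
  have hdesc : ∀ U ∈ M ∪ Ψ, U ⊆ S ∧ (∃ X ∈ D, U ⊆ S \ X) ∧
      ((∃ X ∈ D, f U = petal (j X) ∧ f (S \ U) = petal (i X) ∧ ρ U = rM (i X) (j X) ∧ γ U = gM (i X) (j X)) ∨
       (∃ r ∈ R, f U = bot ∧ f (S \ U) = petal r ∧ ρ U = rΨ r ∧ γ U = gΨ)) := by
    intro U hU
    rcases mem_union.mp hU with hU | hU
    · obtain ⟨X, hX, rfl⟩ := mem_image.mp hU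
      have h1 : f (S \ X) = petal (j X) := hDj X hX
      have h2 : f (S \ (S \ X)) = petal (i X) := by rw [Finset.sdiff_sdiff_eq_self (hDS X hX)]; exact hDi X hX
      exact ⟨sdiff_subset, ⟨X, hX, le_rfl⟩, Or.inl ⟨X, hX, h1, h2, hρM _ _ _ h1 h2⟩⟩
    · rw [hΨ, mem_filter, hG, mem_filter, mem_powerset] at hU
      obtain ⟨⟨hUS, hUbot, hUlab, X, hX, hUX⟩, hUnt⟩ := hU
      rcases hUlab with htop | ⟨r, hrR, hr⟩
      · exact absurd htop hUnt
      · exact ⟨hUS, ⟨X, hX, hUX⟩, Or.inr ⟨r, hrR, hUbot, hr, hρΨ _ _ hUbot hr⟩⟩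
  -- the two groups
  set P : Finset (Finset α) := {U ∈ M ∪ Ψ | γ U = false} with hP
  set Q : Finset (Finset α) := {U ∈ M ∪ Ψ | γ U = true} with hQ
  -- ranked Marica–Schönheim inside a group: differences
  have hdiff : ∀ U ∈ M ∪ Ψ, ∀ U' ∈ M ∪ Ψ, γ U = γ U' → ρ U ≤ ρ U' → U \ U' ∈ G := by
    intro U hU U' hU' hγ hle
    obtain ⟨hUS, hmiss, hUd⟩ := hdesc U hU
    obtain ⟨hU'S, -, hU'd⟩ := hdesc U' hU'
    rcases hUd with ⟨X, hX, hUa, hUb, hUρ, hUγ⟩ | ⟨r, hrR, hUa, hUb, hUρ, hUγ⟩ <;>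
      rcases hU'd with ⟨X', hX', hU'a, hU'b, hU'ρ, hU'γ⟩ | ⟨r', hr'R, hU'a, hU'b, hU'ρ, hU'γ⟩
    · -- member / member
      have hg : gM (i X) (j X) = gM (i X') (j X') := by rw [← hUγ, ← hU'γ]; exact hγ
      have hr : rM (i X) (j X) ≤ rM (i X') (j X') := by rw [← hUρ, ← hU'ρ]; exact hle
      obtain ⟨hne, hor⟩ := (hMM X hX X' hX').1 hg hr
      refine sdiff_mem_enlarged S D R hf G hG hUS hU'S hUb hU'b hmiss (Or.inr ⟨j X, hUa, hne⟩) ?_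
      rcases hor with h | h
      · exact Or.inl h
      · exact Or.inr ⟨j X', hU'a, h⟩
    · -- member / pseudo
      have hg : gM (i X) (j X) = gΨ := by rw [← hUγ, ← hU'γ]; exact hγ
      have hr : rM (i X) (j X) ≤ rΨ r' := by rw [← hUρ, ← hU'ρ]; exact hle
      obtain ⟨hne, hiR⟩ := ((hMΨ X hX r' hr'R).1 hg).2 hr
      exact sdiff_mem_enlarged S D R hf G hG hUS hU'S hUb hU'b hmiss (Or.inr ⟨j X, hUa, hne⟩) (Or.inl hiR)
    · -- pseudo / member
      exact sdiff_mem_enlarged S D R hf G hG hUS hU'S hUb hU'b hmiss (Or.inl hUa) (Or.inl hrR)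
    · -- pseudo / pseudo
      exact sdiff_mem_enlarged S D R hf G hG hUS hU'S hUb hU'b hmiss (Or.inl hUa) (Or.inl hrR)
  -- ranked Marica–Schönheim inside a group: non-containment
  have hnc : ∀ U ∈ M ∪ Ψ, ∀ U' ∈ M ∪ Ψ, γ U = γ U' → ρ U < ρ U' → ¬ U ⊆ U' := by
    intro U hU U' hU' hγ hlt
    obtain ⟨hUS, hmiss, hUd⟩ := hdesc U hU
    obtain ⟨hU'S, -, hU'd⟩ := hdesc U' hU'
    rcases hUd with ⟨X, hX, hUa, hUb, hUρ, hUγ⟩ | ⟨r, hrR, hUa, hUb, hUρ, hUγ⟩ <;>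
      rcases hU'd with ⟨X', hX', hU'a, hU'b, hU'ρ, hU'γ⟩ | ⟨r', hr'R, hU'a, hU'b, hU'ρ, hU'γ⟩
    · -- member / member: different rank forces different type
      by_cases hii : i X = i X'
      · have hjj : j X ≠ j X' := by
          intro hjj
          rw [hUρ, hU'ρ, hii, hjj] at hlt
          exact lt_irrefl _ hlt
        exact not_subset_of_labels S hf (Or.inr (Or.inr ⟨j X, j X', hUa, hU'a, hjj⟩))
      · exact not_subset_of_labels S hf (Or.inl ⟨i X, i X', hUb, hU'b, hii⟩)
    · -- member / pseudo
      exact not_subset_of_labels S hf (Or.inr (Or.inl ⟨j X, hUa, hU'a⟩))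
    · -- pseudo / member
      have hg : gM (i X') (j X') = gΨ := by rw [← hUγ, ← hU'γ]; exact hγ.symm
      have hr : rΨ r < rM (i X') (j X') := by rw [← hUρ, ← hU'ρ]; exact hlt
      have hne : r ≠ i X' := ((hMΨ X' hX' r hrR).1 hg).1 hr
      exact not_subset_of_labels S hf (Or.inl ⟨r, i X', hUb, hU'b, hne⟩)
    · -- pseudo / pseudo
      by_cases hrr : r = r'
      · rw [hUρ, hU'ρ, hrr] at hlt
        exact absurd hlt (lt_irrefl _)
      · exact not_subset_of_labels S hf (Or.inl ⟨r, r', hUb, hU'b, hrr⟩)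
  -- across the groups: certified nonempty meets
  have horth : ∀ U ∈ M ∪ Ψ, ∀ U' ∈ M ∪ Ψ, γ U ≠ γ U' → U ∩ U' ∈ G ∧ (U ∩ U').Nonempty := by
    intro U hU U' hU' hγ
    obtain ⟨hUS, hmiss, hUd⟩ := hdesc U hU
    obtain ⟨hU'S, -, hU'd⟩ := hdesc U' hU'
    rcases hUd with ⟨X, hX, hUa, hUb, hUρ, hUγ⟩ | ⟨r, hrR, hUa, hUb, hUρ, hUγ⟩ <;>
      rcases hU'd with ⟨X', hX', hU'a, hU'b, hU'ρ, hU'γ⟩ | ⟨r', hr'R, hU'a, hU'b, hU'ρ, hU'γ⟩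
    · -- member / member
      have hg : gM (i X) (j X) ≠ gM (i X') (j X') := by rw [← hUγ, ← hU'γ]; exact hγ
      obtain ⟨hjj, hor, hnopp⟩ := (hMM X hX X' hX').2 hg
      refine ⟨inter_mem_enlarged S D R hf G hG hUS hUb hU'b hmiss
        (Or.inr (Or.inr ⟨j X, j X', hUa, hU'a, hjj⟩)) hor, ?_⟩
      by_cases hji : j X = i X'
      · have hne : j X' ≠ i X := fun h => hnopp ⟨h, hji⟩
        rw [inter_comm]
        exact inter_nonempty_of_labels S hf hU'S hU'a hUb hne
      · exact inter_nonempty_of_labels S hf hUS hUa hU'b hji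
    · -- member / pseudo
      have hg : gM (i X) (j X) ≠ gΨ := by rw [← hUγ, ← hU'γ]; exact hγ
      obtain ⟨hor, hjr⟩ := (hMΨ X hX r' hr'R).2 hg
      exact ⟨inter_mem_enlarged S D R hf G hG hUS hUb hU'b hmiss (Or.inr (Or.inl hU'a)) hor,
        inter_nonempty_of_labels S hf hUS hUa hU'b hjr⟩
    · -- pseudo / member
      have hg : gM (i X') (j X') ≠ gΨ := by rw [← hUγ, ← hU'γ]; exact fun h => hγ h.symm
      obtain ⟨-, hjr⟩ := (hMΨ X' hX' r hrR).2 hg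
      refine ⟨inter_mem_enlarged S D R hf G hG hUS hUb hU'b hmiss (Or.inl hUa) (Or.inr hrR), ?_⟩
      rw [inter_comm]
      exact inter_nonempty_of_labels S hf hU'S hU'a hUb hjr
    · -- pseudo / pseudo: same group
      exact absurd (hUγ.trans hU'γ.symm) hγ
  -- the two-group count
  have hPsub : ∀ U ∈ P, U ∈ M ∪ Ψ := fun U hU => (mem_filter.mp hU).1
  have hQsub : ∀ U ∈ Q, U ∈ M ∪ Ψ := fun U hU => (mem_filter.mp hU).1
  have hPγ : ∀ U ∈ P, γ U = false := fun U hU => (mem_filter.mp hU).2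
  have hQγ : ∀ U ∈ Q, γ U = true := fun U hU => (mem_filter.mp hU).2
  have hcount : #P + #Q ≤ #G :=
    card_add_card_le_of_rank G hGdown P Q ρ ρ
      (fun U hU U' hU' h => hdiff U (hPsub U hU) U' (hPsub U' hU') ((hPγ U hU).trans (hPγ U' hU').symm) h)
      (fun U hU U' hU' h => hnc U (hPsub U hU) U' (hPsub U' hU') ((hPγ U hU).trans (hPγ U' hU').symm) h)
      (fun U hU U' hU' h => hdiff U (hQsub U hU) U' (hQsub U' hU') ((hQγ U hU).trans (hQγ U' hU').symm) h)
      (fun U hU U' hU' h => hnc U (hQsub U hU) U' (hQsub U' hU') ((hQγ U hU).trans (hQγ U' hU').symm) h)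
      (fun U hU U' hU' => horth U (hPsub U hU) U' (hQsub U' hU') (by rw [hPγ U hU, hQγ U' hU']; simp))
  -- bookkeeping: `#P + #Q = #D + #Ψ` and `#G = #K + #Ψ`
  have hPQ : #P + #Q = #(M ∪ Ψ) := by
    rw [hP, hQ]
    have h := card_filter_add_card_filter_not (s := M ∪ Ψ) (fun U => γ U = false)
    rw [← h]
    congr 2
    ext U
    simp
  have hinjD : Set.InjOn (fun X => S \ X) (D : Set (Finset α)) := by
    intro X₁ hX₁ X₂ hX₂ h
    have h₁ := Finset.sdiff_sdiff_eq_self (hDS X₁ hX₁)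
    have h₂ := Finset.sdiff_sdiff_eq_self (hDS X₂ hX₂)
    simp only at h
    rw [← h₁, ← h₂, h]
  have hcardM : #M = #D := card_image_of_injOn hinjD
  have hdisj : Disjoint M Ψ := by
    rw [Finset.disjoint_left]
    intro U hUM hUΨ
    obtain ⟨X, hX, rfl⟩ := mem_image.mp hUM
    rw [hΨ, mem_filter, hG, mem_filter] at hUΨ
    have h := hUΨ.1.2.1
    rw [hDj X hX] at h
    exact absurd h (by simp)
  have hcardU : #(M ∪ Ψ) = #D + #Ψ := by rw [card_union_of_disjoint hdisj, hcardM]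
  have hGsplit : #K + #Ψ = #G := by
    rw [hK, hΨ]
    exact card_filter_add_card_filter_not _
  have hDK : #D ≤ #K := by omega
  -- `K` injects into the goods above `D` by complementation
  have hKS : ∀ F ∈ K, F ⊆ S := by
    intro F hF
    rw [hK, mem_filter, hG, mem_filter, mem_powerset] at hF
    exact hF.1.1
  have hinjK : Set.InjOn (fun F => S \ F) (K : Set (Finset α)) := by
    intro F₁ hF₁ F₂ hF₂ h
    have h₁ := Finset.sdiff_sdiff_eq_self (hKS F₁ hF₁)
    have h₂ := Finset.sdiff_sdiff_eq_self (hKS F₂ hF₂)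
    simp only at h
    rw [← h₁, ← h₂, h]
  have himg : K.image (fun F => S \ F) ⊆
      {U ∈ S.powerset | f U = top ∧ f (S \ U) = bot ∧ ∃ X ∈ D, X ⊆ U} := by
    intro U hU
    obtain ⟨F, hF, rfl⟩ := mem_image.mp hU
    have hFS := hKS F hF
    rw [hK, mem_filter, hG, mem_filter] at hF
    obtain ⟨⟨-, hFbot, -, X, hX, hFX⟩, hFtop⟩ := hF
    rw [mem_filter, mem_powerset, Finset.sdiff_sdiff_eq_self hFS]
    refine ⟨sdiff_subset, hFtop, hFbot, X, hX, ?_⟩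
    intro a ha
    exact mem_sdiff.mpr ⟨hDS X hX ha, fun haF => (mem_sdiff.mp (hFX haF)).2 ha⟩
  calc #D ≤ #K := hDK
    _ = #(K.image fun F => S \ F) := (card_image_of_injOn hinjK).symm
    _ ≤ #{U ∈ S.powerset | f U = top ∧ f (S \ U) = bot ∧ ∃ X ∈ D, X ⊆ U} := card_le_card himg

/-- **Uniform oriented antipodal Hall theorem from a two-group certificate, SDR form.**  Under the hypotheses of
`card_le_card_goods_above_of_twoGroupCert` the members of `D` have DISTINCT good representatives above them. -/
theorem exists_injective_good_above_of_twoGroupCert (S : Finset α) {f : Finset α → Lab k}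
    (hf : ∀ ⦃X Y : Finset α⦄, X ⊆ Y → f X ≤ f Y) (D : Finset (Finset α)) (i j : Finset α → Fin k)
    (hDS : ∀ X ∈ D, X ⊆ S) (hDi : ∀ X ∈ D, f X = petal (i X)) (hDj : ∀ X ∈ D, f (S \ X) = petal (j X))
    (R : Finset (Fin k)) (gM : Fin k → Fin k → Bool) (rM : Fin k → Fin k → ℕ) (gΨ : Bool) (rΨ : Fin k → ℕ)
    (hMM : ∀ X ∈ D, ∀ X' ∈ D,
      (gM (i X) (j X) = gM (i X') (j X') → rM (i X) (j X) ≤ rM (i X') (j X') →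
        (j X ≠ i X' ∧ (i X ∈ R ∨ i X ≠ j X'))) ∧
      (gM (i X) (j X) ≠ gM (i X') (j X') →
        (j X ≠ j X' ∧ (i X ≠ i X' ∨ i X ∈ R) ∧ ¬ (j X' = i X ∧ j X = i X'))))
    (hMΨ : ∀ X ∈ D, ∀ r ∈ R,
      (gM (i X) (j X) = gΨ →
        (rΨ r < rM (i X) (j X) → r ≠ i X) ∧ (rM (i X) (j X) ≤ rΨ r → (j X ≠ r ∧ i X ∈ R))) ∧
      (gM (i X) (j X) ≠ gΨ → ((i X ≠ r ∨ i X ∈ R) ∧ j X ≠ r))) :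
    ∃ φ : D → Finset α, Function.Injective φ ∧
      ∀ X : D, (X : Finset α) ⊆ φ X ∧ φ X ⊆ S ∧ f (φ X) = top ∧ f (S \ φ X) = bot := by
  classical
  let t : D → Finset (Finset α) := fun X =>
    {U ∈ S.powerset | f U = top ∧ f (S \ U) = bot ∧ (X : Finset α) ⊆ U}
  have hHall : ∀ s : Finset D, #s ≤ #(s.biUnion t) := by
    intro s
    set D' : Finset (Finset α) := s.map (Function.Embedding.subtype _) with hD'
    have hD'sub : ∀ X ∈ D', X ∈ D := by
      intro X hX
      obtain ⟨x, -, rfl⟩ := mem_map.mp hX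
      exact x.2
    have hcard : #s = #D' := (card_map _).symm
    have hle := card_le_card_goods_above_of_twoGroupCert S hf D' i j (fun X hX => hDS X (hD'sub X hX))
      (fun X hX => hDi X (hD'sub X hX)) (fun X hX => hDj X (hD'sub X hX)) R gM rM gΨ rΨ
      (fun X hX X' hX' => hMM X (hD'sub X hX) X' (hD'sub X' hX'))
      (fun X hX r hr => hMΨ X (hD'sub X hX) r hr)
    have hgoods : {U ∈ S.powerset | f U = top ∧ f (S \ U) = bot ∧ ∃ X ∈ D', X ⊆ U} ⊆
        s.biUnion t := by
      intro U hU
      rw [mem_filter, mem_powerset] at hU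
      obtain ⟨hUS, hUtop, hUbot, X, hX, hXU⟩ := hU
      obtain ⟨x, hx, rfl⟩ := mem_map.mp hX
      rw [mem_biUnion]
      refine ⟨x, hx, ?_⟩
      simp only [t, mem_filter, mem_powerset]
      exact ⟨hUS, hUtop, hUbot, hXU⟩
    calc #s = #D' := hcard
      _ ≤ #{U ∈ S.powerset | f U = top ∧ f (S \ U) = bot ∧ ∃ X ∈ D', X ⊆ U} := hle
      _ ≤ #(s.biUnion t) := card_le_card hgoods
  obtain ⟨φ, hφinj, hφ⟩ := (all_card_le_biUnion_card_iff_exists_injective t).mp hHall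
  refine ⟨φ, hφinj, fun X => ?_⟩
  have hX := hφ X
  simp only [t, mem_filter, mem_powerset] at hX
  exact ⟨hX.2.2.2, hX.1, hX.2.1, hX.2.2.1⟩

/-- **Table form.**  If the types of `D` lie in a finite set `T` of ordered petal pairs for which the two-group
certificate conditions have been checked ONCE on labels (`hcert`, a decidable statement — `by decide` for a concrete
table entry), the members of `D` have distinct good representatives. -/
theorem exists_injective_good_above_of_certTable (T : Finset (Fin k × Fin k)) (R : Finset (Fin k))
    (gM : Fin k → Fin k → Bool) (rM : Fin k → Fin k → ℕ) (gΨ : Bool) (rΨ : Fin k → ℕ)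
    (hcert : (∀ t ∈ T, ∀ t' ∈ T,
        (gM t.1 t.2 = gM t'.1 t'.2 → rM t.1 t.2 ≤ rM t'.1 t'.2 → (t.2 ≠ t'.1 ∧ (t.1 ∈ R ∨ t.1 ≠ t'.2))) ∧
        (gM t.1 t.2 ≠ gM t'.1 t'.2 → (t.2 ≠ t'.2 ∧ (t.1 ≠ t'.1 ∨ t.1 ∈ R) ∧ ¬ (t'.2 = t.1 ∧ t.2 = t'.1)))) ∧
      (∀ t ∈ T, ∀ r ∈ R,
        (gM t.1 t.2 = gΨ → (rΨ r < rM t.1 t.2 → r ≠ t.1) ∧ (rM t.1 t.2 ≤ rΨ r → (t.2 ≠ r ∧ t.1 ∈ R))) ∧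
        (gM t.1 t.2 ≠ gΨ → ((t.1 ≠ r ∨ t.1 ∈ R) ∧ t.2 ≠ r))))
    (S : Finset α) {f : Finset α → Lab k} (hf : ∀ ⦃X Y : Finset α⦄, X ⊆ Y → f X ≤ f Y)
    (D : Finset (Finset α)) (i j : Finset α → Fin k) (hDS : ∀ X ∈ D, X ⊆ S)
    (hDi : ∀ X ∈ D, f X = petal (i X)) (hDj : ∀ X ∈ D, f (S \ X) = petal (j X))
    (hT : ∀ X ∈ D, (i X, j X) ∈ T) :
    ∃ φ : D → Finset α, Function.Injective φ ∧
      ∀ X : D, (X : Finset α) ⊆ φ X ∧ φ X ⊆ S ∧ f (φ X) = top ∧ f (S \ φ X) = bot :=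
  exists_injective_good_above_of_twoGroupCert S hf D i j hDS hDi hDj R gM rM gΨ rΨ
    (fun X hX X' hX' => hcert.1 (i X, j X) (hT X hX) (i X', j X') (hT X' hX'))
    (fun X hX r hr => hcert.2 (i X, j X) (hT X hX) r hr)

end OrientedAntipodalHall

end Summit.CriticalPhenomena.PercolationContinuityZ3.Theorems
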